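import Summits.Langlands.Langlands.Statement
import Literature.NumberTheory.Automorphic.RamakrishnanAsaiTransferGL2
import HarnessLib

/-!
# Line `AsaiGL3` — ON-PATH FILE (F4; forward generator G4 ladder-down, generation 26)
# top crux `ReciprocityUpToIrreducibility` (stmt-Langlands-14328)

`Langlands → AsaiReciprocity N` for every `N ≥ 1` (restriction of clause (B) at rank `N * N` over `F` to the `Rec`
the summit provides: the family's de Rham clause is against `fontainePstAdicCompletion = Rec.pst` by `rfl`, a.e.
unramifiedness is read off the sector hypothesis, cuspidal ⇒ automorphic, `Corresponds` ⊃ a.e. Satake), and the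
`@[aesop safe apply]` instance `AsaiGL3_of_Langlands` used by the kernel's on-path test (family: verbatim copy of
`Lines/AsaiGL3.lean` §1).  No `sorry`.
-/

noncomputable section

set_option linter.dupNamespace false

open scoped MatrixGroups Matrix NumberField Classical Polynomial
open Filter IsDedekindDomain Field Polynomial NumberField
open Literature.NumberTheory.Automorphic Literature.NumberTheory.GaloisRepresentations
open Literature.NumberTheory.PAdicHodge
open Summit.Langlands

namespace Summit.Langlands.Langlands.Cruxes.ReciprocityUpToIrreducibility.AsaiGL3

/-! ## 1. The graded family (dial = the rank `N` on the `E`-side, target rank `N * N`) and the rung `N = 3` -/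

/-- **The rung family** `AsaiReciprocity N`: clause (B) of the summit over EVERY number field `F`, every quadratic
extension `E/F` (non-trivial automorphism `c`), every `ℓ` and `ι : ℚ̄_ℓ ≃ ℂ`, in the a.e.-Satake form, for
irreducible `ρ : Γ_F → GL_{N²}(ℚ̄_ℓ)` de Rham above `ℓ` (pinned Fontaine datum `fontainePstAdicCompletion`) which, at
all but finitely many places `v`, are unramified with Frobenius characteristic polynomial the `ι`-Satake polynomial
of every multiset `γ` whose Euler polynomial `∏ (1 - γ_k T)` is the unramified Asai polynomial
`asaiLocalPolynomial c A 1 w = det(1 - As(t_v) T)` (at split `v = w w̄`: `det(1 - t_w ⊗ t_{w̄} T)`; at inert `v`: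
`∏_i (1 - a_i T) ∏_{i<j} (1 - a_i a_j T²)`) of a Satake family `A` that is an Asai datum (for SOME finite exceptional set `S`) of a CUSPIDAL `Π` on
`GL_N(𝔸_E)` — the unramified shadow of "`ρ ≅ As_{E/F}(ρ_Π)`".  Conclusion: an AUTOMORPHIC `P` on `GL_{N²}(𝔸_F)` (Borel–Jacquet
datum, not asserted cuspidal) with `SatakeFrobCompatibleAt ι P ρ v` for almost all `v`.  Implied by the summit and
by E for every `N ≥ 1` (`…_of_langlands`, `…_of_top`); implied by `WeakAsaiFunctoriality N`
(`of_weakAsaiFunctoriality`), hence PROVED at `N = 2` modulo the named fact; OPEN at `N = 3` (`GL₃/E → GL₉/F`). -/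
def AsaiReciprocity (N : ℕ) : Prop :=
  ∀ (F E : Type) [Field F] [NumberField F] [Field E] [NumberField E] [Algebra F E],
    Module.finrank F E = 2 → ∀ c : E ≃ₐ[F] E, c ≠ 1 →
    ∀ (hE : isCompact_glFiniteIntegralLevel N E) (piE : CuspidalAutomorphicRepData N E hE)
      (A : SatakeFamily E), (∃ S : Set (HeightOneSpectrum (𝓞 F)), piE.1.IsAsaiDatum c S A) →
    ∀ (ℓ : ℕ) [Fact ℓ.Prime] (ι : PadicAlgCl ℓ ≃+* ℂ) (ρ : FramedGaloisRep F (PadicAlgCl ℓ) (N * N)),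
      ρ.toGaloisRep.IsIrreducible →
      (∀ (v : HeightOneSpectrum (𝓞 F)) (hv : ((ℓ : ℕ) : 𝓞 F) ∈ v.asIdeal),
          (fontainePstAdicCompletion v ℓ hv).IsDeRhamFramed (ρ.toLocal v)) →
      (∀ᶠ v : HeightOneSpectrum (𝓞 F) in cofinite, ρ.IsUnramifiedAt v ∧
          ∀ w : HeightOneSpectrum (𝓞 E), w.under (𝓞 F) = v →
            ∀ γ : Multiset ℂ, eulerPolynomial γ = asaiLocalPolynomial c A 1 w →
              ρ.HasFrobCharpolyAt v (arithFrobPolyOfSatake ι v.residueCard 1 γ)) →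
      ∀ hF : isCompact_glFiniteIntegralLevel (N * N) F,
        ∃ P : AutomorphicRepData (AutomorphyDatum.gl (N * N) F hF),
          ∀ᶠ v : HeightOneSpectrum (𝓞 F) in cofinite, SatakeFrobCompatibleAt ι P ρ v

/-- **THE RUNG** (the filed statement): the family at `N = 3` — clause (B) for irreducible de Rham
`GL₉`-representations of Asai type `As_{E/F}(GL₃)` over every number field and every quadratic `E/F`. -/
def AsaiGL3 : Prop := AsaiReciprocity 3

/-- The floor cell `N = 2` of the family as a decl (decided modulo the named fact, `floor_two`). -/
def AsaiGL2 : Prop := AsaiReciprocity 2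

/-! ## On-path: the summit implies every cell of the family -/

/-- **Dial monotonicity in the summit direction**: `Langlands → AsaiReciprocity N` for every `N ≥ 1` — clause (B) at
rank `N²` over `F` for the reciprocity datum the summit provides. -/
theorem asaiReciprocity_of_langlands (N : ℕ) (hN : 1 ≤ N) (hL : _root_.Langlands) : AsaiReciprocity N := by
  intro F E _ _ _ _ _ h2 c hc hEcpt piE A hSA ℓ _ ι ρ hirr hdR hsec hF
  obtain ⟨⟨Rec⟩, hall⟩ := hL F
  have hpos : 0 < N * N := Nat.mul_pos hN hN
  have hB : GaloisToAutomorphic (N * N) Rec hF := (hall Rec (N * N) hpos hF).2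
  have hgeo : IsGeometricFramed Rec ρ := ⟨hsec.mono fun v hv => hv.1, fun v hv => hdR v hv⟩
  obtain ⟨π', -, hcorr⟩ := hB ℓ ι ρ hirr hgeo
  exact ⟨π'.1, hcorr.1⟩

/-- **F4 on-path lemma for the rung**: `Langlands → AsaiGL3`. -/
@[aesop safe apply]
theorem AsaiGL3_of_Langlands (hL : _root_.Langlands) : AsaiGL3 :=
  asaiReciprocity_of_langlands 3 (by norm_num) hL

/-- Kernel form of the on-path test. -/
example : _root_.Langlands → AsaiGL3 := by aesop

end Summit.Langlands.Langlands.Cruxes.ReciprocityUpToIrreducibility.AsaiGL3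

end
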